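import Summits.Ventures.DiscreteObjects.Hadamard.OrbitSumsSigned
import Summits.Ventures.DiscreteObjects.Hadamard.PrimeOrderFixedRows668

/-!
# H(668): the Hadamard-form orbit-sum identity for automorphisms of order 23, 37 and 167 (kernel)

Framing: lottery ticket; floor = certified bounds/negative ranges.

Cell pub-namedobj (venture DiscreteObjects), target (H), hadamard gen 9.  The pattern of `hadamard668_orbitSum_identity_41`
(gen 7) for the three primes whose orbit-matrix levels gen 9 decided: for a Hadamard matrix of order `668` with a signed
automorphism `(π, κ, d, e)` of order `p ∈ {23, 37, 167}`, the re-signed equivalent matrix (`exists_resign_of_odd`) carries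
`(π, κ)` as a permutation automorphism pair with the kernel-forced number of fixed rows/columns (`1+1` or `24+24` for 23;
`2+2` for 37; `0+0` for 167) and its orbit block sums satisfy the weighted identity `Σ_j w_j · bsum i j · bsum i' j =
p² · 668 · |orbit i ∩ orbit i'|`, i.e. the orbit matrix `Θ = [[A, √p B],[√p C, F]]` has `Θ Θᵀ = 668·I` — the NECESSITY side of
the orbit-matrix level; the SATISFIABILITY side is `Z23OrbitMatrixCertificate` (fixed-point-free type), `Z37OrbitMatrixCertificate`
and, for 167, any odd `4 × 4` integer matrix with `A Aᵀ = 668 I₄` (e.g. the quaternion matrix of `(25,5,3,3)`).  So none of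
`23` (fpf type), `37`, `167` is excluded at the orbit-matrix level.  Ours, not literature; no `sorry`.
-/

open Finset BigOperators Matrix

namespace Summit.Ventures.DiscreteObjects.Hadamard

open Literature.Combinatorics.Designs.GoethalsSeidel (IsHadamardMatrix)

variable {ι : Type*} [Fintype ι] [DecidableEq ι]

/-- **H(668), order 37**: `2 + 2` fixed rows/columns and the orbit-sum identity `Θ Θᵀ = 668 I` (18 + 2 rows/columns). -/
theorem hadamard668_orbitSum_identity_37 {H : Matrix ι ι ℤ} (hH : IsHadamardMatrix H) (hι : Fintype.card ι = 668)
    (π κ : Equiv.Perm ι) (d e : ι → ℤ) (haut : IsSignedAut H π κ d e)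
    (hπ : π ^ 37 = 1) (hκ : κ ^ 37 = 1) (hne : π ≠ 1 ∨ κ ≠ 1) :
    (univ.filter fun i => π i = i).card = 2 ∧ (univ.filter fun j => κ j = j).card = 2 ∧
    ∃ s t : ι → ℤ, (∀ i, s i = 1 ∨ s i = -1) ∧ (∀ j, t j = 1 ∨ t j = -1) ∧
      IsHadamardMatrix (Matrix.of fun i j => s i * t j * H i j) ∧
      (∀ i j, (Matrix.of fun i j => s i * t j * H i j) (π i) (κ j) = (Matrix.of fun i j => s i * t j * H i j) i j) ∧
      ∀ i i' : ι,
        ∑ j, (if κ j = j then ((37 : ℤ) ^ 2) else 1) *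
            bsum (Matrix.of fun i j => s i * t j * H i j) π κ 37 i j *
            bsum (Matrix.of fun i j => s i * t j * H i j) π κ 37 i' j =
          (37 : ℤ) ^ 2 * 668 * ((orbFin π 37 i ∩ orbFin π 37 i').card : ℤ) := by
  have hcount := hadamard668_fixedRows_37 hH hι π κ d e haut hπ hκ hne
  refine ⟨hcount.1, hcount.2, ?_⟩
  obtain ⟨s, t, hs, ht, hH', hinv', hid⟩ :=
    orbitSum_identity_signed hH haut (by norm_num : (37 : ℕ).Prime) (by decide : Odd 37) hπ hκ
  refine ⟨s, t, hs, ht, hH', hinv', fun i i' => ?_⟩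
  have h := hid i i'
  rw [hι] at h
  exact_mod_cast h

/-- **H(668), order 23**: `1 + 1` or `24 + 24` fixed rows/columns and the orbit-sum identity (29 + 1 resp. 28 + 24
rows/columns). -/
theorem hadamard668_orbitSum_identity_23 {H : Matrix ι ι ℤ} (hH : IsHadamardMatrix H) (hι : Fintype.card ι = 668)
    (π κ : Equiv.Perm ι) (d e : ι → ℤ) (haut : IsSignedAut H π κ d e)
    (hπ : π ^ 23 = 1) (hκ : κ ^ 23 = 1) (hne : π ≠ 1 ∨ κ ≠ 1) :
    (((univ.filter fun i => π i = i).card = 1 ∧ (univ.filter fun j => κ j = j).card = 1) ∨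
     ((univ.filter fun i => π i = i).card = 24 ∧ (univ.filter fun j => κ j = j).card = 24)) ∧
    ∃ s t : ι → ℤ, (∀ i, s i = 1 ∨ s i = -1) ∧ (∀ j, t j = 1 ∨ t j = -1) ∧
      IsHadamardMatrix (Matrix.of fun i j => s i * t j * H i j) ∧
      (∀ i j, (Matrix.of fun i j => s i * t j * H i j) (π i) (κ j) = (Matrix.of fun i j => s i * t j * H i j) i j) ∧
      ∀ i i' : ι,
        ∑ j, (if κ j = j then ((23 : ℤ) ^ 2) else 1) *
            bsum (Matrix.of fun i j => s i * t j * H i j) π κ 23 i j *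
            bsum (Matrix.of fun i j => s i * t j * H i j) π κ 23 i' j =
          (23 : ℤ) ^ 2 * 668 * ((orbFin π 23 i ∩ orbFin π 23 i').card : ℤ) := by
  refine ⟨hadamard668_fixedRows_23 hH hι π κ d e haut hπ hκ hne, ?_⟩
  obtain ⟨s, t, hs, ht, hH', hinv', hid⟩ :=
    orbitSum_identity_signed hH haut (by norm_num : (23 : ℕ).Prime) (by decide : Odd 23) hπ hκ
  refine ⟨s, t, hs, ht, hH', hinv', fun i i' => ?_⟩
  have h := hid i i'
  rw [hι] at h
  exact_mod_cast h

/-- **H(668), order 167**: no fixed rows/columns (`4 + 4` orbits) and the orbit-sum identity — here every column weight is `1`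
and the identity reads `A Aᵀ = 668 I₄` for the `4 × 4` matrix of orbit sums. -/
theorem hadamard668_orbitSum_identity_167 {H : Matrix ι ι ℤ} (hH : IsHadamardMatrix H) (hι : Fintype.card ι = 668)
    (π κ : Equiv.Perm ι) (d e : ι → ℤ) (haut : IsSignedAut H π κ d e)
    (hπ : π ^ 167 = 1) (hκ : κ ^ 167 = 1) (hne : π ≠ 1 ∨ κ ≠ 1) :
    (univ.filter fun i => π i = i).card = 0 ∧ (univ.filter fun j => κ j = j).card = 0 ∧
    (blockClasses π 167).card = 4 ∧ (blockClasses κ 167).card = 4 ∧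
    ∃ s t : ι → ℤ, (∀ i, s i = 1 ∨ s i = -1) ∧ (∀ j, t j = 1 ∨ t j = -1) ∧
      IsHadamardMatrix (Matrix.of fun i j => s i * t j * H i j) ∧
      (∀ i j, (Matrix.of fun i j => s i * t j * H i j) (π i) (κ j) = (Matrix.of fun i j => s i * t j * H i j) i j) ∧
      ∀ i i' : ι,
        ∑ j, (if κ j = j then ((167 : ℤ) ^ 2) else 1) *
            bsum (Matrix.of fun i j => s i * t j * H i j) π κ 167 i j *
            bsum (Matrix.of fun i j => s i * t j * H i j) π κ 167 i' j =
          (167 : ℤ) ^ 2 * 668 * ((orbFin π 167 i ∩ orbFin π 167 i').card : ℤ) := by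
  have h167 := hadamard668_fixedRows_167 hH hι π κ d e haut hπ hκ hne
  refine ⟨h167.1, h167.2.1, h167.2.2.1, h167.2.2.2, ?_⟩
  obtain ⟨s, t, hs, ht, hH', hinv', hid⟩ :=
    orbitSum_identity_signed hH haut (by norm_num : (167 : ℕ).Prime) (by decide : Odd 167) hπ hκ
  refine ⟨s, t, hs, ht, hH', hinv', fun i i' => ?_⟩
  have h := hid i i'
  rw [hι] at h
  exact_mod_cast h

end Summit.Ventures.DiscreteObjects.Hadamard
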